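import Literature.NumberTheory.Automorphic.WhittakerModels
import Literature.NumberTheory.Automorphic.GLnAdelicStructure
import Literature.NumberTheory.Automorphic.MirabolicTower
import HarnessLib

/-!
# Support of bi-`ψ`-equivariant Whittaker functions on a corner of `GL_N` over a discretely valued field

Topic `NumberTheory/Automorphic`; namespace `Literature.NumberTheory.Automorphic`. Local algebraic
groundwork for the finite-place half of the named fact `JacquetShalika1981_partialPairL_pole_of_eq_conj`
(`PairLFunctionPoles`; Arthur–Clozel (1989), Ch. 3 (2.3)) in every rank: an explicit, elementary
substitute for the "bottom piece of the Bernstein–Zelevinsky filtration" of the Kirillov model.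

Let `F` be a field valued in `ℤ ∪ {∞}` (Mathlib `Valued F ℤᵐ⁰`, `|x| = exp(-ord x)`), `ψ` an additive
character of `F` which is non-trivial somewhere on `𝔭^{c₀-1} = {|x| ≤ exp(1-c₀)}`, `N = N_N ≤ GL_N(F)`
the upper unitriangular group with its generic character `ψ_N(u) = ψ(u₁₂ + ⋯ + u_{N-1,N})`
(`upperUnitriangular`, `whittakerCharFun`), and `t₀, …, t_{N-1} ∈ Fˣ` with decreasing valuations and
gaps `|t_i / t_{i+1}| ≥ exp(M - c₀)`, `M ≥ 1`. Suppose `W : GL_N(F) → ℂ` satisfies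

* `W(u g) = ψ_N(u) W(g)` for all `u ∈ N` (a Whittaker function);
* `W(g u) = ψ_N(u) W(g)` for the `u ∈ N` with `|u_{ij}| ≤ |t_i / t_j|` (the vector is
  `ψ_N`-isotypic under the "spread" compact piece `N ∩ d GL_N(𝒪) d⁻¹` of `N`, `d = diag(t)`);
* `W(g κ) = W(g)` whenever `|(κ - 1)_{ij}| ≤ exp(-M) |t_i / t_j|` (level `d K(𝔭^M) d⁻¹`).

**Main theorem** (`exists_eq_unipotent_mul_integral_of_mem_cornerGL`): if `g` lies in a proper corner
`GL_d × 1_{N-d}` (`cornerGL N F d`, `d < N`) and `W(g) ≠ 0`, then `g ∈ N · GL_N(𝒪)`. In particular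
(`valuation_eq_one_of_glDiagonal_mul_ne_zero`) if `g = diag(a₀, …, a_{d-1}, 1, …, 1) · k₀` with
`k₀ ∈ GL_N(𝒪)` in the corner then all `|a_i| = 1`: the restriction of `W` to the corner torus times
`GL_d(𝒪)` is supported on units. Proof: right multiplication by the transvection
`1 + c E_{i,d}` (`i < d`, `|c| ≤ |t_i/t_d|`) is left multiplication by the unipotent
`1 + c (g e_i) ⊗ e_d`, so comparing the two equivariances gives `ψ(c (g_{d-1,i} - δ_{d-1,i})) = 1`
for all such `c`, whence `|g_{d-1,i} - δ| ≤ exp(-c₀) |t_d / t_i|` (`valuation_mul_le_of_forall_addChar_eq_one`);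
the row-`(d-1)` matrix `k = 1 + e_{d-1} ⊗ (g_{d-1,·} - δ)` then lies in the level group and in
`GL_N(𝒪)`, `g k⁻¹` has row `d - 1` equal to `e_{d-1}` and splits as (column unipotent) × (element of
the corner `GL_{d-1}`), and one concludes by induction on `d`. No Haar measure, no Jacquet module,
no Kirillov theory is used. The consumer combines it with a twisted average over
`N ∩ d GL_N(𝒪_v) d⁻¹` (which produces the second hypothesis) and a test function supported near
`e_N` at the place `v`, to see that the `v`-part of the unfolded Rankin–Selberg integral of such a
vector is a finite sum (Jacquet–Piatetski-Shapiro–Shalika (1983), (2.7), p. 393: the local integral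
"can be made constant"; Bernstein–Zelevinsky (1976), §5, the `P_n`-filtration — neither is used or
formalised here; the statements below are [folklore] consequences of the two equivariances).

All proofs complete; no named fact, no `sorry`.

## References

* I. N. Bernstein, A. V. Zelevinsky, *Representations of the group GL(n, F) where F is a local
  non-archimedean field*, Russian Math. Surveys 31:3 (1976), §5 [BernsteinZelevinsky1976].
* H. Jacquet, I. I. Piatetski-Shapiro, J. A. Shalika, *Rankin–Selberg convolutions*, Amer. J. Math.
  105 (1983), §2, (2.7) [JacquetPiatetskiShapiroShalika1983].
-/

noncomputable section

open Matrix WithZero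
open scoped MatrixGroups

namespace Literature.NumberTheory.Automorphic

namespace WhittakerSupport

variable {F : Type*} [Field F]

/-! ### Rank-one perturbations of the identity as elements of `GL_N` (Sherman–Morrison) -/

section RankOne

variable {N : ℕ}

/-- `(b ⊗ r)² = (r · b) (b ⊗ r)`. [folklore] -/
theorem vecMulVec_mul_self (b r : Fin N → F) :
    vecMulVec b r * vecMulVec b r = (r ⬝ᵥ b) • vecMulVec b r := by
  rw [vecMulVec_mul_vecMulVec]
  ext i j
  simp [vecMulVec_apply, mul_left_comm]

/-- `(1 + b ⊗ r)(1 + c (b ⊗ r)) = 1 + (1 + c + c (r · b)) (b ⊗ r)`. [folklore] -/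
theorem one_add_mul_one_add_smul (b r : Fin N → F) (c : F) :
    ((1 : Matrix (Fin N) (Fin N) F) + vecMulVec b r) * (1 + c • vecMulVec b r) =
      1 + (1 + c + c * (r ⬝ᵥ b)) • vecMulVec b r := by
  rw [mul_add, mul_one, add_mul, one_mul, Matrix.mul_smul, vecMulVec_mul_self, smul_smul, add_smul,
    add_smul, one_smul]
  abel

/-- `(1 + c (b ⊗ r))(1 + b ⊗ r) = 1 + (1 + c + c (r · b)) (b ⊗ r)`. [folklore] -/
theorem one_add_smul_mul_one_add (b r : Fin N → F) (c : F) :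
    ((1 : Matrix (Fin N) (Fin N) F) + c • vecMulVec b r) * (1 + vecMulVec b r) =
      1 + (1 + c + c * (r ⬝ᵥ b)) • vecMulVec b r := by
  rw [add_mul, one_mul, mul_add, mul_one, Matrix.smul_mul, vecMulVec_mul_self, smul_smul, add_smul,
    add_smul, one_smul]
  abel

/-- **Sherman–Morrison for the identity**: if `1 + r · b ≠ 0` then `1 + b ⊗ r ∈ GL_N(F)` with inverse
`1 - (1 + r · b)⁻¹ (b ⊗ r)`. [folklore] -/
def oneAddGL (b r : Fin N → F) (h : 1 + r ⬝ᵥ b ≠ 0) : GL (Fin N) F where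
  val := 1 + vecMulVec b r
  inv := 1 + (-(1 + r ⬝ᵥ b)⁻¹) • vecMulVec b r
  val_inv := by
    rw [one_add_mul_one_add_smul]
    have hs : (1 + r ⬝ᵥ b)⁻¹ * (1 + r ⬝ᵥ b) = 1 := inv_mul_cancel₀ h
    have : (1 + -(1 + r ⬝ᵥ b)⁻¹ + -(1 + r ⬝ᵥ b)⁻¹ * (r ⬝ᵥ b)) = 0 := by linear_combination -hs
    rw [this, zero_smul, add_zero]
  inv_val := by
    rw [one_add_smul_mul_one_add]
    have hs : (1 + r ⬝ᵥ b)⁻¹ * (1 + r ⬝ᵥ b) = 1 := inv_mul_cancel₀ h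
    have : (1 + -(1 + r ⬝ᵥ b)⁻¹ + -(1 + r ⬝ᵥ b)⁻¹ * (r ⬝ᵥ b)) = 0 := by linear_combination -hs
    rw [this, zero_smul, add_zero]

/-- The matrix of `oneAddGL b r h` is `1 + b ⊗ r`. [folklore] -/
@[simp]
theorem coe_oneAddGL (b r : Fin N → F) (h : 1 + r ⬝ᵥ b ≠ 0) :
    ((oneAddGL b r h : GL (Fin N) F) : Matrix (Fin N) (Fin N) F) = 1 + vecMulVec b r := rfl

/-- The matrix of `(oneAddGL b r h)⁻¹` is `1 - (1 + r · b)⁻¹ (b ⊗ r)` (written `1 + (-(1 + r·b)⁻¹) (b ⊗ r)`). [folklore] -/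
@[simp]
theorem coe_oneAddGL_inv (b r : Fin N → F) (h : 1 + r ⬝ᵥ b ≠ 0) :
    (((oneAddGL b r h)⁻¹ : GL (Fin N) F) : Matrix (Fin N) (Fin N) F) =
      1 + (-(1 + r ⬝ᵥ b)⁻¹) • vecMulVec b r := rfl

/-- Entries of `1 + b ⊗ r`. [folklore] -/
theorem one_add_vecMulVec_apply (b r : Fin N → F) (i j : Fin N) :
    ((1 : Matrix (Fin N) (Fin N) F) + vecMulVec b r) i j = (if i = j then 1 else 0) + b i * r j := by
  rw [Matrix.add_apply, Matrix.one_apply, vecMulVec_apply]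

/-- **Pushing a rank-one perturbation through `g`**: if the row `r` is fixed by `g` on the right,
`r g = r`, then `g (1 + b ⊗ r) = (1 + (g b) ⊗ r) g`. [folklore] -/
theorem mul_one_add_vecMulVec_eq (g : Matrix (Fin N) (Fin N) F) (b r : Fin N → F) (hr : r ᵥ* g = r) :
    g * (1 + vecMulVec b r) = (1 + vecMulVec (g *ᵥ b) r) * g := by
  rw [mul_add, mul_one, add_mul, one_mul, mul_vecMulVec, vecMulVec_mul, hr]

end RankOne

/-! ### Column and row perturbations; unipotent columns and their character -/

section ColRow

variable {N : ℕ}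

/-- The column perturbation `1 + b ⊗ e_j` (`b_j = 0`), an element of `GL_N`; for `b` supported on the
rows `< j` this is the unipotent matrix with column `j` equal to `e_j + b`. [folklore] -/
def colGL (b : Fin N → F) (j : Fin N) (hb : b j = 0) : GL (Fin N) F :=
  oneAddGL b (Pi.single j 1) (by rw [single_one_dotProduct, hb, add_zero]; exact one_ne_zero)

/-- The row perturbation `1 + e_d ⊗ r` (`1 + r_d ≠ 0`), an element of `GL_N`: the identity matrix with
row `d` replaced by `e_d + r`. [folklore] -/
def rowGL (r : Fin N → F) (d : Fin N) (hr : 1 + r d ≠ 0) : GL (Fin N) F :=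
  oneAddGL (Pi.single d 1) r (by rwa [dotProduct_single_one])

/-- Entries of `colGL b j`. [folklore] -/
theorem colGL_apply (b : Fin N → F) (j : Fin N) (hb : b j = 0) (l m : Fin N) :
    ((colGL b j hb : GL (Fin N) F) : Matrix (Fin N) (Fin N) F) l m =
      (if l = m then 1 else 0) + if m = j then b l else 0 := by
  rw [colGL, coe_oneAddGL, one_add_vecMulVec_apply, Pi.single_apply, mul_ite, mul_one, mul_zero]

/-- Entries of `(colGL b j)⁻¹ = 1 - b ⊗ e_j`. [folklore] -/
theorem colGL_inv_apply (b : Fin N → F) (j : Fin N) (hb : b j = 0) (l m : Fin N) :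
    (((colGL b j hb)⁻¹ : GL (Fin N) F) : Matrix (Fin N) (Fin N) F) l m =
      (if l = m then 1 else 0) - if m = j then b l else 0 := by
  rw [colGL, coe_oneAddGL_inv, single_one_dotProduct, hb, add_zero, inv_one, Matrix.add_apply,
    Matrix.one_apply, Matrix.smul_apply, vecMulVec_apply, Pi.single_apply, smul_eq_mul]
  split_ifs <;> ring

/-- Entries of `rowGL r d`. [folklore] -/
theorem rowGL_apply (r : Fin N → F) (d : Fin N) (hr : 1 + r d ≠ 0) (l m : Fin N) :
    ((rowGL r d hr : GL (Fin N) F) : Matrix (Fin N) (Fin N) F) l m =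
      (if l = m then 1 else 0) + if l = d then r m else 0 := by
  rw [rowGL, coe_oneAddGL, one_add_vecMulVec_apply, Pi.single_apply, ite_mul, one_mul, zero_mul]

/-- Entries of `(rowGL r d)⁻¹ = 1 - (1 + r_d)⁻¹ e_d ⊗ r`. [folklore] -/
theorem rowGL_inv_apply (r : Fin N → F) (d : Fin N) (hr : 1 + r d ≠ 0) (l m : Fin N) :
    (((rowGL r d hr)⁻¹ : GL (Fin N) F) : Matrix (Fin N) (Fin N) F) l m =
      (if l = m then 1 else 0) + if l = d then -(1 + r d)⁻¹ * r m else 0 := by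
  rw [rowGL, coe_oneAddGL_inv, dotProduct_single_one, Matrix.add_apply, Matrix.one_apply,
    Matrix.smul_apply, vecMulVec_apply, Pi.single_apply, smul_eq_mul]
  split_ifs <;> ring

/-- **`1 + b ⊗ e_j` is upper unitriangular when `b` is supported on the rows `< j`.** [folklore] -/
theorem colGL_mem_upperUnitriangular (b : Fin N → F) (j : Fin N) (hb : ∀ l, j ≤ l → b l = 0) :
    colGL b j (hb j le_rfl) ∈ upperUnitriangular (Fin N) F := by
  rw [mem_upperUnitriangular_iff]
  refine ⟨fun l m hml => ?_, fun l => ?_⟩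
  · change (m : Fin N) < l at hml
    rw [colGL_apply, if_neg (ne_of_gt hml), zero_add]
    split_ifs with hmj
    · subst hmj; exact hb l hml.le
    · rfl
  · rw [colGL_apply, if_pos rfl]
    split_ifs with hlj
    · subst hlj; rw [hb l le_rfl, add_zero]
    · rw [add_zero]

/-- **The generic character of `1 + b ⊗ e_j` is `ψ(b_{j-1})`**: the only super-diagonal entry is
`b_d` at `(d, j)`, `d + 1 = j`. [folklore] -/
theorem whittakerCharFun_colGL (ψ : AddChar F Circle) (b : Fin N → F) (j : Fin N)
    (hb : ∀ l, j ≤ l → b l = 0) (d : Fin N) (hd : (d : ℕ) + 1 = j) :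
    whittakerCharFun ψ ⟨colGL b j (hb j le_rfl), colGL_mem_upperUnitriangular b j hb⟩ = ψ (b d) := by
  rw [whittakerCharFun_apply, superdiagSum_def]
  congr 2
  change ∑ l : Fin N, ∑ m : Fin N, (if (l : ℕ) + 1 = m then
    ((colGL b j (hb j le_rfl) : GL (Fin N) F) : Matrix (Fin N) (Fin N) F) l m else 0) = b d
  have hdj : d ≠ j := fun h => by rw [h] at hd; omega
  have inner : ∀ l : Fin N, (∑ m : Fin N, if (l : ℕ) + 1 = m then
      ((colGL b j (hb j le_rfl) : GL (Fin N) F) : Matrix (Fin N) (Fin N) F) l m else 0) =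
      if l = d then b d else 0 := by
    intro l
    rw [Finset.sum_eq_single j]
    · by_cases hl : l = d
      · subst hl
        rw [if_pos hd, if_pos rfl, colGL_apply, if_neg hdj, if_pos rfl, zero_add]
      · rw [if_neg hl, if_neg]
        intro h
        exact hl (Fin.ext (by omega))
    · intro m _ hmj
      rw [colGL_apply, if_neg hmj, add_zero]
      split_ifs with h1 h2
      · exfalso; rw [h2] at h1; omega
      · rfl
      · rfl
    · intro h; exact absurd (Finset.mem_univ j) h
  simp_rw [inner]
  rw [Finset.sum_ite_eq' Finset.univ d, if_pos (Finset.mem_univ d)]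

/-- **Splitting off the corner**: if `p` lies in the corner `GL_{d+1} ≤ GL_N` and its row `d` is the
unit row `e_d`, then `p = u c` with `u = 1 + b ⊗ e_d` upper unitriangular (`b` = column `d` of `p`
above the diagonal) and `c` in the corner `GL_d`. [folklore] -/
theorem exists_colGL_mul_of_row_eq {d : ℕ} (iD : Fin N) (hiD : (iD : ℕ) = d) {p : GL (Fin N) F}
    (hp : p ∈ cornerGL N F (d + 1))
    (hrow : ∀ m : Fin N, (p : Matrix (Fin N) (Fin N) F) iD m = if iD = m then 1 else 0) :
    ∃ (b : Fin N → F) (hb : ∀ l : Fin N, iD ≤ l → b l = 0) (c : GL (Fin N) F),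
      c ∈ cornerGL N F d ∧ p = colGL b iD (hb _ le_rfl) * c := by
  set b : Fin N → F := fun l => (p : Matrix (Fin N) (Fin N) F) l iD - if l = iD then 1 else 0 with hbdef
  have hb : ∀ l : Fin N, iD ≤ l → b l = 0 := by
    intro l hl
    rcases hl.lt_or_eq with hlt | heq
    · have hl' : d + 1 ≤ (l : ℕ) := by
        have : (iD : ℕ) < l := hlt
        omega
      simp only [hbdef]
      rw [hp l iD (Or.inl hl'), if_neg (ne_of_gt hlt), sub_zero]
    · simp only [hbdef]
      rw [← heq, hrow iD, if_pos rfl, sub_self]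
  refine ⟨b, hb, (colGL b iD (hb _ le_rfl))⁻¹ * p, ?_, by rw [mul_inv_cancel_left]⟩
  -- the corner condition for `c = u⁻¹ p`: `c_{lm} = p_{lm} - b_l δ_{dm}`
  have hc : ∀ l m : Fin N, (((colGL b iD (hb _ le_rfl))⁻¹ * p : GL (Fin N) F) : Matrix (Fin N) (Fin N) F) l m =
      (p : Matrix (Fin N) (Fin N) F) l m - b l * (if iD = m then 1 else 0) := by
    intro l m
    rw [Units.val_mul, Matrix.mul_apply]
    have : ∀ x : Fin N, (((colGL b iD (hb _ le_rfl))⁻¹ : GL (Fin N) F) : Matrix (Fin N) (Fin N) F) l x *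
        (p : Matrix (Fin N) (Fin N) F) x m =
        (if l = x then (p : Matrix (Fin N) (Fin N) F) l m else 0) -
          if x = iD then b l * (p : Matrix (Fin N) (Fin N) F) iD m else 0 := by
      intro x
      rw [colGL_inv_apply, sub_mul]
      congr 1
      · split_ifs with h
        · subst h; rw [one_mul]
        · rw [zero_mul]
      · split_ifs with h
        · subst h; rfl
        · rw [zero_mul]
    simp_rw [this]
    rw [Finset.sum_sub_distrib, Finset.sum_ite_eq Finset.univ l, if_pos (Finset.mem_univ l),
      Finset.sum_ite_eq' Finset.univ iD, if_pos (Finset.mem_univ iD), hrow m]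
  intro l m hlm
  rw [hc l m]
  rcases hlm with hl | hm
  · -- rows `≥ d`
    rcases (show iD ≤ l from Fin.le_def.2 (by omega)).lt_or_eq with hlt | heq
    · have hl' : d + 1 ≤ (l : ℕ) := by
        have : (iD : ℕ) < l := hlt
        omega
      rw [hp l m (Or.inl hl'), hb l hlt.le, zero_mul, sub_zero]
    · rw [← heq, hrow m, hb iD le_rfl, zero_mul, sub_zero]
  · -- columns `≥ d`
    rcases (show iD ≤ m from Fin.le_def.2 (by omega)).lt_or_eq with hlt | heq
    · have hm' : d + 1 ≤ (m : ℕ) := by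
        have : (iD : ℕ) < m := hlt
        omega
      rw [hp l m (Or.inr hm'), if_neg (ne_of_lt hlt), mul_zero, sub_zero]
    · rw [← heq, if_pos rfl, mul_one]
      simp only [hbdef]
      rw [sub_sub_cancel]

end ColRow

/-! ### From triviality of `ψ` on small multiples to a valuation bound -/

section Valued

variable [Valued F ℤᵐ⁰]

local notation "𝓋" => (Valued.v : Valuation F ℤᵐ⁰)

/-- **If `ψ(C y) = 1` for all `y` with `|y| G₂ ≤ G₁`, then `|C| G₁ ≤ exp(-c₀) G₂`**, provided `ψ` is
non-trivial on some `x` with `|x| ≤ exp(1 - c₀)` (i.e. the conductor of `ψ` is not contained in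
`𝔭^{c₀ - 1}`). (Contrapositive: otherwise `y = x / C` is admissible and `ψ(C y) = ψ(x) ≠ 1`.)
[folklore] -/
theorem valuation_mul_le_of_forall_addChar_eq_one (ψ : AddChar F Circle) {c₀ : ℤ}
    (hψ : ∃ x : F, 𝓋 x ≤ exp (1 - c₀) ∧ ψ x ≠ 1) {C : F} {G₁ G₂ : ℤᵐ⁰} (hG₁ : G₁ ≠ 0) (hG₂ : G₂ ≠ 0)
    (h : ∀ y : F, 𝓋 y * G₂ ≤ G₁ → ψ (C * y) = 1) : 𝓋 C * G₁ ≤ exp (-c₀) * G₂ := by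
  obtain ⟨x, hx, hψx⟩ := hψ
  by_contra hlt
  rw [not_le] at hlt
  have hC : C ≠ 0 := by
    rintro rfl
    rw [Valuation.map_zero, zero_mul] at hlt
    exact not_lt_of_ge zero_le hlt
  have hx0 : x ≠ 0 := by
    rintro rfl
    exact hψx (AddChar.map_zero_eq_one ψ)
  have hvC : 𝓋 C ≠ 0 := (Valuation.ne_zero_iff _).2 hC
  have hvx : 𝓋 x ≠ 0 := (Valuation.ne_zero_iff _).2 hx0
  obtain ⟨vc, evc⟩ : ∃ vc : ℤ, 𝓋 C = exp vc := ⟨log (𝓋 C), (exp_log hvC).symm⟩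
  obtain ⟨vx, evx⟩ : ∃ vx : ℤ, 𝓋 x = exp vx := ⟨log (𝓋 x), (exp_log hvx).symm⟩
  obtain ⟨g₁, eg₁⟩ : ∃ g₁ : ℤ, G₁ = exp g₁ := ⟨log G₁, (exp_log hG₁).symm⟩
  obtain ⟨g₂, eg₂⟩ : ∃ g₂ : ℤ, G₂ = exp g₂ := ⟨log G₂, (exp_log hG₂).symm⟩
  rw [evc, eg₁, eg₂, ← exp_add, ← exp_add, exp_lt_exp] at hlt
  rw [evx, exp_le_exp] at hx
  have hy : 𝓋 (x / C) * G₂ ≤ G₁ := by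
    rw [map_div₀, evx, evc, eg₁, eg₂, ← exp_sub, ← exp_add, exp_le_exp]
    omega
  have := h (x / C) hy
  rw [← mul_div_assoc, mul_div_cancel_left₀ _ hC] at this
  exact hψx this

end Valued

/-! ### The main theorem -/

section Main

variable [Valued F ℤᵐ⁰] {N : ℕ}

local notation "𝓋" => (Valued.v : Valuation F ℤᵐ⁰)

/-- **The hypotheses on `W : GL_N(F) → ℂ`.** For an additive character `ψ`, parameters
`t : Fin N → Fˣ` (the diagonal of the conjugating torus element `d = diag(t)`) and a level exponent
`M`: `W` is a `ψ_N`-Whittaker function on the left, is `ψ_N`-isotypic on the right under the unipotent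
matrices `u` with `d⁻¹ u d` integral (`|u_{ij} t_j| ≤ |t_i|`), and is right invariant under the `κ`
with `d⁻¹ κ d ≡ 1 (mod 𝔭^M)` (`|(κ - 1)_{ij} t_j| ≤ exp(-M) |t_i|`). [folklore] -/
structure IsSpreadWhittaker (ψ : AddChar F Circle) (t : Fin N → Fˣ) (M : ℤ)
    (W : GL (Fin N) F → ℂ) : Prop where
  /-- `W(u g) = ψ_N(u) W(g)` for `u ∈ N_N`. -/
  left : ∀ (u : GL (Fin N) F) (hu : u ∈ upperUnitriangular (Fin N) F) (g : GL (Fin N) F),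
    W (u * g) = whittakerCharFun ψ ⟨u, hu⟩ * W g
  /-- `W(g u) = ψ_N(u) W(g)` for `u ∈ N_N` with `d⁻¹ u d` integral. -/
  right : ∀ (u : GL (Fin N) F) (hu : u ∈ upperUnitriangular (Fin N) F),
    (∀ i j, 𝓋 ((u : Matrix (Fin N) (Fin N) F) i j * t j) ≤ 𝓋 (t i : F)) →
    ∀ g : GL (Fin N) F, W (g * u) = whittakerCharFun ψ ⟨u, hu⟩ * W g
  /-- `W(g κ) = W(g)` for `κ` with `d⁻¹ κ^{±1} d ≡ 1 (mod 𝔭^M)`. -/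
  level : ∀ κ : GL (Fin N) F,
    (∀ i j, 𝓋 (((κ : Matrix (Fin N) (Fin N) F) - 1) i j * t j) ≤ exp (-M) * 𝓋 (t i : F)) →
    (∀ i j, 𝓋 ((((κ⁻¹ : GL (Fin N) F) : Matrix (Fin N) (Fin N) F) - 1) i j * t j) ≤ exp (-M) * 𝓋 (t i : F)) →
    ∀ g : GL (Fin N) F, W (g * κ) = W g

/-- **Support theorem.** Under the hypotheses `IsSpreadWhittaker ψ t M W`, with `ψ` non-trivial
somewhere on `{|x| ≤ exp(1 - c₀)}`, `M ≥ 1`, `|t_j| ≤ |t_i|` for `i ≤ j` and gaps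
`exp(M - c₀) |t_{i+1}| ≤ |t_i|`: if `g` lies in the corner `GL_d ≤ GL_N` with `d < N` and
`W(g) ≠ 0`, then `g = u k` with `u ∈ N_N(F)` and `k ∈ GL_N(𝒪)`. [folklore] -/
theorem exists_eq_unipotent_mul_integral_of_mem_cornerGL (ψ : AddChar F Circle) {c₀ M : ℤ}
    (hψ : ∃ x : F, 𝓋 x ≤ exp (1 - c₀) ∧ ψ x ≠ 1) (hM₁ : 1 ≤ M)
    {t : Fin N → Fˣ} (hmono : ∀ i j : Fin N, i ≤ j → 𝓋 (t j : F) ≤ 𝓋 (t i : F))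
    (hgap : ∀ i j : Fin N, (i : ℕ) + 1 = j → exp (M - c₀) * 𝓋 (t j : F) ≤ 𝓋 (t i : F))
    {W : GL (Fin N) F → ℂ} (hW : IsSpreadWhittaker ψ t M W) :
    ∀ {d : ℕ} (_ : d < N) {g : GL (Fin N) F}, g ∈ cornerGL N F d → W g ≠ 0 →
      ∃ u ∈ upperUnitriangular (Fin N) F, ∃ k ∈ valuedCongruenceSubgroup (Fin N) (1 : ℤᵐ⁰),
        g = u * k := by
  have ht0 : ∀ i, 𝓋 (t i : F) ≠ 0 := fun i => (Valuation.ne_zero_iff _).2 (t i).ne_zero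
  have hexpM : exp (-M) ≤ (1 : ℤᵐ⁰) := by rw [← exp_zero, exp_le_exp]; omega
  have hexpM1 : exp (-M) < (1 : ℤᵐ⁰) := by rw [← exp_zero, exp_lt_exp]; omega
  intro d
  induction d with
  | zero =>
    intro _ g hg _
    refine ⟨1, one_mem _, 1, one_mem _, ?_⟩
    rw [one_mul]
    refine Units.ext (Matrix.ext fun i j => ?_)
    rw [hg i j (Or.inl (Nat.zero_le _)), Units.val_one, Matrix.one_apply]
  | succ d ih =>
    intro hd g hg hne
    -- the row index `d` and the column index `d + 1`
    set iD : Fin N := ⟨d, by omega⟩ with hiD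
    set jD : Fin N := ⟨d + 1, hd⟩ with hjD
    have hij : (iD : ℕ) + 1 = jD := rfl
    have hiDjD : iD ≠ jD := fun h => by
      have := congrArg Fin.val h
      simp [hiD, hjD] at this
    have hgE : ∀ l m : Fin N, (d + 1 ≤ (l : ℕ) ∨ d + 1 ≤ (m : ℕ)) →
        (g : Matrix (Fin N) (Fin N) F) l m = if l = m then 1 else 0 := hg
    -- the deviation of the row `d` of `g` from the unit row
    set D : Fin N → F := fun m => (g : Matrix (Fin N) (Fin N) F) iD m - if iD = m then 1 else 0 with hD
    have hD0 : ∀ m : Fin N, ¬ (m : ℕ) ≤ d → D m = 0 := by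
      intro m hm
      simp only [hD]
      rw [hgE iD m (Or.inr (by omega)), sub_self]
    -- Step 1: consistency of the left and right equivariances on the column group
    have hcons : ∀ i : Fin N, (i : ℕ) ≤ d → ∀ c : F, 𝓋 c * 𝓋 (t jD : F) ≤ 𝓋 (t i : F) →
        ψ (D i * c) = 1 := by
      intro i hi c hc
      have hijD : (i : ℕ) < jD := by change (i : ℕ) < d + 1; omega
      have hbT : ∀ l : Fin N, jD ≤ l → (Pi.single i c : Fin N → F) l = 0 := by
        intro l hl
        rw [Pi.single_apply, if_neg]
        intro h
        rw [h] at hl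
        exact absurd (Fin.lt_def.2 hijD) (not_lt.2 hl)
      set b' : Fin N → F := (g : Matrix (Fin N) (Fin N) F) *ᵥ Pi.single i c with hb'
      have hb'apply : ∀ l, b' l = (g : Matrix (Fin N) (Fin N) F) l i * c := fun l => by
        simp only [hb', mulVec, dotProduct_single]
      have hb'0 : ∀ l : Fin N, jD ≤ l → b' l = 0 := by
        intro l hl
        have hl' : d + 1 ≤ (l : ℕ) := hl
        rw [hb'apply, hgE l i (Or.inl hl'), if_neg, zero_mul]
        intro h
        rw [h] at hl'
        omega
      -- `g T = T' g`
      have hprod : g * colGL (Pi.single i c) jD (hbT jD le_rfl) = colGL b' jD (hb'0 jD le_rfl) * g := by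
        refine Units.ext ?_
        change (g : Matrix (Fin N) (Fin N) F) * (1 + vecMulVec (Pi.single i c) (Pi.single jD 1)) =
          (1 + vecMulVec b' (Pi.single jD 1)) * g
        rw [hb']
        refine mul_one_add_vecMulVec_eq _ _ _ ?_
        rw [single_one_vecMul]
        funext m
        change (g : Matrix (Fin N) (Fin N) F) jD m = (Pi.single jD (1 : F) : Fin N → F) m
        rw [hgE jD m (Or.inl le_rfl), Pi.single_apply]
        by_cases h : jD = m
        · rw [if_pos h, if_pos h.symm]
        · rw [if_neg h, if_neg (Ne.symm h)]
      -- the valuation bounds for `T`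
      have hTbd : ∀ l m : Fin N, 𝓋 (((colGL (Pi.single i c) jD (hbT jD le_rfl) : GL (Fin N) F) :
          Matrix (Fin N) (Fin N) F) l m * t m) ≤ 𝓋 (t l : F) := by
        intro l m
        rw [colGL_apply, Pi.single_apply]
        by_cases hlm : l = m
        · subst hlm
          rw [if_pos rfl]
          by_cases hlj : l = jD
          · rw [if_pos hlj, if_neg, add_zero, one_mul]
            intro hli
            rw [hli] at hlj
            exact absurd hlj.symm (ne_of_lt (Fin.lt_def.2 hijD)).symm
          · rw [if_neg hlj, add_zero, one_mul]
        · rw [if_neg hlm, zero_add]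
          by_cases hmj : m = jD
          · rw [if_pos hmj]
            by_cases hli : l = i
            · rw [if_pos hli, hmj, hli, Valuation.map_mul]
              exact hc
            · rw [if_neg hli, zero_mul, Valuation.map_zero]
              exact zero_le
          · rw [if_neg hmj, zero_mul, Valuation.map_zero]
            exact zero_le
      have h1 := hW.right _ (colGL_mem_upperUnitriangular _ jD hbT) hTbd g
      have h2 := hW.left _ (colGL_mem_upperUnitriangular _ jD hb'0) g
      rw [hprod] at h1
      rw [h1] at h2
      have h3 := mul_right_cancel₀ hne h2
      rw [whittakerCharFun_colGL ψ _ jD hbT iD hij, whittakerCharFun_colGL ψ _ jD hb'0 iD hij,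
        Circle.coe_inj, hb'apply, Pi.single_apply] at h3
      -- `h3 : ψ (if iD = i then c else 0) = ψ (g_{d i} c)`
      have hDc : D i * c = (g : Matrix (Fin N) (Fin N) F) iD i * c - (if iD = i then c else 0) := by
        simp only [hD]
        split_ifs <;> ring
      rw [hDc, AddChar.map_sub_eq_div, ← h3, div_self']
    -- Step 2: valuation bounds for the row `d` of `g`
    have hbound : ∀ i : Fin N, (i : ℕ) ≤ d → 𝓋 (D i) * 𝓋 (t i : F) ≤ exp (-M) * 𝓋 (t iD : F) := by
      intro i hi
      have hA := valuation_mul_le_of_forall_addChar_eq_one ψ hψ (ht0 i) (ht0 jD) (hcons i hi)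
      refine hA.trans ?_
      have hg' := hgap iD jD hij
      calc exp (-c₀) * 𝓋 (t jD : F) = exp (-M) * (exp (M - c₀) * 𝓋 (t jD : F)) := by
            rw [← mul_assoc, ← exp_add]
            congr 2
            ring
        _ ≤ exp (-M) * 𝓋 (t iD : F) := mul_le_mul_right hg' _
    have hDint : ∀ m : Fin N, 𝓋 (D m) ≤ exp (-M) := by
      intro m
      by_cases hm : (m : ℕ) ≤ d
      · have hle : m ≤ iD := Fin.le_def.2 hm
        have h : 𝓋 (D m) * 𝓋 (t m : F) ≤ exp (-M) * 𝓋 (t m : F) :=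
          (hbound m hm).trans (mul_le_mul_right (hmono m iD hle) _)
        exact le_of_mul_le_mul_right h (zero_lt_iff.mpr (ht0 m))
      · rw [hD0 m hm, Valuation.map_zero]
        exact zero_le
    have hDint1 : ∀ m : Fin N, 𝓋 (D m) ≤ 1 := fun m => (hDint m).trans hexpM
    have hgdd : (g : Matrix (Fin N) (Fin N) F) iD iD = 1 + D iD := by
      simp only [hD]
      rw [if_pos trivial]
      ring
    have hvdd : 𝓋 (1 + D iD) = 1 := Valuation.map_one_add_of_lt _ ((hDint iD).trans_lt hexpM1)
    have hk1 : 1 + D iD ≠ 0 := fun h => by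
      rw [h, Valuation.map_zero] at hvdd
      exact zero_ne_one hvdd
    -- Step 3: the row matrix `k = 1 + e_d ⊗ D`; its row `d` is the row `d` of `g`
    set k : GL (Fin N) F := rowGL D iD hk1 with hk
    have hkapply := rowGL_apply D iD hk1
    have hklevel : ∀ l m : Fin N,
        𝓋 ((((k : GL (Fin N) F) : Matrix (Fin N) (Fin N) F) - 1) l m * t m) ≤ exp (-M) * 𝓋 (t l : F) := by
      intro l m
      rw [Matrix.sub_apply, hkapply, Matrix.one_apply, add_sub_cancel_left]
      by_cases hl : l = iD
      · rw [if_pos hl, hl]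
        by_cases hm : (m : ℕ) ≤ d
        · rw [Valuation.map_mul]
          exact hbound m hm
        · rw [hD0 m hm, zero_mul, Valuation.map_zero]
          exact zero_le
      · rw [if_neg hl, zero_mul, Valuation.map_zero]
        exact zero_le
    have hklevel' : ∀ l m : Fin N,
        𝓋 ((((k⁻¹ : GL (Fin N) F) : Matrix (Fin N) (Fin N) F) - 1) l m * t m) ≤ exp (-M) * 𝓋 (t l : F) := by
      intro l m
      rw [Matrix.sub_apply, hk, rowGL_inv_apply, Matrix.one_apply, add_sub_cancel_left]
      by_cases hl : l = iD
      · rw [if_pos hl, hl, Valuation.map_mul, Valuation.map_mul, Valuation.map_neg, map_inv₀, hvdd,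
          inv_one, one_mul, ← Valuation.map_mul]
        by_cases hm : (m : ℕ) ≤ d
        · rw [Valuation.map_mul]
          exact hbound m hm
        · rw [hD0 m hm, zero_mul, Valuation.map_zero]
          exact zero_le
      · rw [if_neg hl, zero_mul, Valuation.map_zero]
        exact zero_le
    have hkK : k ∈ valuedCongruenceSubgroup (Fin N) (1 : ℤᵐ⁰) := by
      refine ⟨fun l m => ?_, fun l m => ?_, fun l m => ?_⟩
      · rw [hkapply]
        refine Valuation.map_add_le _ ?_ ?_
        · split_ifs <;> simp
        · split_ifs
          · exact hDint1 m
          · simp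
      · rw [hk, rowGL_inv_apply]
        refine Valuation.map_add_le _ ?_ ?_
        · split_ifs <;> simp
        · split_ifs
          · rw [Valuation.map_mul, Valuation.map_neg, map_inv₀, hvdd, inv_one, one_mul]
            exact hDint1 m
          · simp
      · rw [Matrix.sub_apply, hkapply, Matrix.one_apply, add_sub_cancel_left]
        split_ifs
        · exact hDint1 m
        · simp
    have hkcorner : k ∈ cornerGL N F (d + 1) := by
      intro l m hlm
      rw [hkapply]
      rcases hlm with hl | hm
      · have hliD : l ≠ iD := by
          intro h
          rw [h] at hl
          change d + 1 ≤ d at hl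
          omega
        rw [if_neg hliD, add_zero]
      · by_cases hl : l = iD
        · rw [if_pos hl, hD0 m (by omega), add_zero]
        · rw [if_neg hl, add_zero]
    -- `p = g k⁻¹` lies in the corner, has unit row `d`, and `W p ≠ 0`
    have hp : g * k⁻¹ ∈ cornerGL N F (d + 1) := mul_mem hg (inv_mem hkcorner)
    have hprow : ∀ m : Fin N, ((g * k⁻¹ : GL (Fin N) F) : Matrix (Fin N) (Fin N) F) iD m =
        if iD = m then 1 else 0 := by
      intro m
      have hrowk : ∀ x : Fin N, (g : Matrix (Fin N) (Fin N) F) iD x =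
          ((k : GL (Fin N) F) : Matrix (Fin N) (Fin N) F) iD x := by
        intro x
        rw [hkapply, if_pos rfl]
        simp only [hD]
        ring
      rw [Units.val_mul, Matrix.mul_apply]
      simp_rw [hrowk]
      rw [← Matrix.mul_apply, ← Units.val_mul, mul_inv_cancel, Units.val_one, Matrix.one_apply]
    have hWp : W (g * k⁻¹) ≠ 0 := by
      have h := hW.level k hklevel hklevel' (g * k⁻¹)
      rw [inv_mul_cancel_right] at h
      rwa [h] at hne
    -- Step 4: split off the corner `GL_d` and apply the induction hypothesis
    obtain ⟨b, hb, c, hc, hpc⟩ := exists_colGL_mul_of_row_eq iD rfl hp hprow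
    have hWc : W c ≠ 0 := by
      have h := hW.left (colGL b iD (hb _ le_rfl)) (colGL_mem_upperUnitriangular b iD hb) c
      rw [← hpc] at h
      intro h0
      rw [h0, mul_zero] at h
      exact hWp h
    obtain ⟨u', hu', k', hk', hck⟩ := ih (by omega) hc hWc
    refine ⟨colGL b iD (hb _ le_rfl) * u', mul_mem (colGL_mem_upperUnitriangular b iD hb) hu',
      k' * k, mul_mem hk' hkK, ?_⟩
    calc g = g * k⁻¹ * k := by rw [inv_mul_cancel_right]
      _ = colGL b iD (hb _ le_rfl) * c * k := by rw [hpc]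
      _ = colGL b iD (hb _ le_rfl) * u' * (k' * k) := by rw [hck]; simp only [mul_assoc]

/-- **A diagonal matrix in `N_N(F) · GL_N(𝒪)` has unit entries.** [folklore] -/
theorem valuation_eq_one_of_glDiagonal_eq_mul {c : Fin N → Fˣ} {u k : GL (Fin N) F}
    (hu : u ∈ upperUnitriangular (Fin N) F) (hk : k ∈ valuedCongruenceSubgroup (Fin N) (1 : ℤᵐ⁰))
    (h : glDiagonal N F c = u * k) (i : Fin N) : 𝓋 (c i : F) = 1 := by
  have hk' : k = u⁻¹ * glDiagonal N F c := by rw [h, inv_mul_cancel_left]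
  have hu' := (mem_upperUnitriangular_iff _).1 (inv_mem hu)
  have hu'' := (mem_upperUnitriangular_iff _).1 hu
  -- `k_{ii} = c_i`
  have h1 : ((k : GL (Fin N) F) : Matrix (Fin N) (Fin N) F) i i = c i := by
    rw [hk', Units.val_mul, coe_glDiagonal, Matrix.mul_diagonal, hu'.2 i, one_mul]
  -- `(k⁻¹)_{ii} = c_i⁻¹`
  have h2 : (((k⁻¹ : GL (Fin N) F)) : Matrix (Fin N) (Fin N) F) i i = ((c i)⁻¹ : Fˣ) := by
    rw [hk', _root_.mul_inv_rev, inv_inv, ← map_inv, Units.val_mul, coe_glDiagonal, Matrix.diagonal_mul,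
      hu''.2 i, mul_one, Pi.inv_apply]
  have hle : 𝓋 (c i : F) ≤ 1 := by
    have := hk.1 i i
    rwa [h1] at this
  have hge : 𝓋 ((c i : F)⁻¹) ≤ 1 := by
    have := hk.2.1 i i
    rwa [h2, Units.val_inv_eq_inv_val] at this
  refine le_antisymm hle ?_
  have hc0 : 𝓋 (c i : F) ≠ 0 := (Valuation.ne_zero_iff _).2 (c i).ne_zero
  rw [map_inv₀] at hge
  have := mul_le_mul_left hge (𝓋 (c i : F))
  rwa [inv_mul_cancel₀ hc0, one_mul] at this

/-- **Torus form of the support theorem.** Let `N = n + 1`, keep the hypotheses of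
`exists_eq_unipotent_mul_integral_of_mem_cornerGL`, and assume moreover that non-vanishing of `W` is
insensitive to the centre (`W(g) ≠ 0 → W(z g) ≠ 0`, as for a function with a unitary central
character). If `W(diag(a) k₀) ≠ 0` for a diagonal `a` and `k₀ ∈ GL_N(𝒪)` whose last row is
`≡ (0, …, 0, *)` modulo `𝔭^{m₀}` with `exp(-m₀) |t₀| ≤ exp(-M) |t_n|`, then all the entries of `a`
have the same valuation: `|a_i| = |a_n|`. (With a test function supported on `e_N + 𝔭^{m₀} 𝒪^N`
at the place in question, these are exactly the torus points that contribute to the local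
Rankin–Selberg integral, and `|a_n| = 1` there.) [folklore] -/
theorem valuation_eq_of_glDiagonal_mul_ne_zero {n : ℕ} (ψ : AddChar F Circle) {c₀ M : ℤ}
    (hψ : ∃ x : F, 𝓋 x ≤ exp (1 - c₀) ∧ ψ x ≠ 1) (hM₁ : 1 ≤ M)
    {t : Fin (n + 1) → Fˣ} (hmono : ∀ i j : Fin (n + 1), i ≤ j → 𝓋 (t j : F) ≤ 𝓋 (t i : F))
    (hgap : ∀ i j : Fin (n + 1), (i : ℕ) + 1 = j → exp (M - c₀) * 𝓋 (t j : F) ≤ 𝓋 (t i : F))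
    {W : GL (Fin (n + 1)) F → ℂ} (hW : IsSpreadWhittaker ψ t M W)
    (hcent : ∀ (z : Fˣ) (g : GL (Fin (n + 1)) F), W g ≠ 0 → W (glDiagonal (n + 1) F (fun _ => z) * g) ≠ 0)
    {m₀ : ℤ} (hm₀ : exp (-m₀) * 𝓋 (t 0 : F) ≤ exp (-M) * 𝓋 (t (Fin.last n) : F))
    (a : Fin (n + 1) → Fˣ) {k₀ : GL (Fin (n + 1)) F}
    (hk₀ : k₀ ∈ valuedCongruenceSubgroup (Fin (n + 1)) (1 : ℤᵐ⁰))
    (hlast : ∀ m : Fin (n + 1), m ≠ Fin.last n →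
      𝓋 ((k₀ : Matrix (Fin (n + 1)) (Fin (n + 1)) F) (Fin.last n) m) ≤ exp (-m₀))
    (hne : W (glDiagonal (n + 1) F a * k₀) ≠ 0) (i : Fin (n + 1)) :
    𝓋 (a i : F) = 𝓋 (a (Fin.last n) : F) := by
  set L : Fin (n + 1) := Fin.last n with hL
  have ht0 : ∀ i, 𝓋 (t i : F) ≠ 0 := fun i => (Valuation.ne_zero_iff _).2 (t i).ne_zero
  have hexpM : exp (-M) ≤ (1 : ℤᵐ⁰) := by rw [← exp_zero, exp_le_exp]; omega
  have hexpM1 : exp (-M) < (1 : ℤᵐ⁰) := by rw [← exp_zero, exp_lt_exp]; omega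
  -- `exp(-m₀) ≤ exp(-M) < 1`
  have hm₀M : exp (-m₀) ≤ exp (-M) := by
    have h : exp (-m₀) * 𝓋 (t 0 : F) ≤ exp (-M) * 𝓋 (t 0 : F) :=
      hm₀.trans (mul_le_mul_right (hmono 0 L (Fin.zero_le _)) _)
    exact le_of_mul_le_mul_right h (zero_lt_iff.mpr (ht0 0))
  have hm₀1 : exp (-m₀) < (1 : ℤᵐ⁰) := hm₀M.trans_lt hexpM1
  -- the corner entry `τ₀ = (k₀)_{nn}` is a unit
  set τ₀ : F := (k₀ : Matrix (Fin (n + 1)) (Fin (n + 1)) F) L L with hτ₀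
  have hτ₀v : 𝓋 τ₀ = 1 := by
    refine le_antisymm (hk₀.1 L L) ?_
    by_contra hlt
    rw [not_le] at hlt
    have hsum : ∑ m : Fin (n + 1), (k₀ : Matrix (Fin (n + 1)) (Fin (n + 1)) F) L m *
        ((k₀⁻¹ : GL (Fin (n + 1)) F) : Matrix (Fin (n + 1)) (Fin (n + 1)) F) m L = 1 := by
      rw [← Matrix.mul_apply, ← Units.val_mul, mul_inv_cancel, Units.val_one, Matrix.one_apply_eq]
    have hlt1 : 𝓋 (∑ m : Fin (n + 1), (k₀ : Matrix (Fin (n + 1)) (Fin (n + 1)) F) L m *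
        ((k₀⁻¹ : GL (Fin (n + 1)) F) : Matrix (Fin (n + 1)) (Fin (n + 1)) F) m L) < 1 := by
      refine Valuation.map_sum_lt _ one_ne_zero fun m _ => ?_
      rw [Valuation.map_mul]
      by_cases hm : m = L
      · rw [hm]
        calc 𝓋 τ₀ * 𝓋 (((k₀⁻¹ : GL (Fin (n + 1)) F) : Matrix (Fin (n + 1)) (Fin (n + 1)) F) L L)
            ≤ 𝓋 τ₀ * 1 := mul_le_mul_right (hk₀.2.1 L L) _
          _ < 1 := by rwa [mul_one]
      · calc 𝓋 ((k₀ : Matrix (Fin (n + 1)) (Fin (n + 1)) F) L m) *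
            𝓋 (((k₀⁻¹ : GL (Fin (n + 1)) F) : Matrix (Fin (n + 1)) (Fin (n + 1)) F) m L)
            ≤ exp (-m₀) * 1 := mul_le_mul' (hlast m hm) (hk₀.2.1 m L)
          _ < 1 := by rwa [mul_one]
    rw [hsum, Valuation.map_one] at hlt1
    exact lt_irrefl _ hlt1
  have hτ₀0 : τ₀ ≠ 0 := fun h => by rw [h, Valuation.map_zero] at hτ₀v; exact zero_ne_one hτ₀v
  -- remove the centre: `g' = (a_n τ₀)⁻¹ diag(a) k₀` has last row `(τ₀⁻¹ (k₀)_{n,·})`, corner entry `1`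
  set z : Fˣ := a L * Units.mk0 τ₀ hτ₀0 with hz
  set g' : GL (Fin (n + 1)) F := glDiagonal (n + 1) F (fun _ => z⁻¹) * (glDiagonal (n + 1) F a * k₀) with hg'
  have hne' : W g' ≠ 0 := hcent z⁻¹ _ hne
  have hg'apply : ∀ l m : Fin (n + 1), (g' : Matrix (Fin (n + 1)) (Fin (n + 1)) F) l m =
      (z⁻¹ : Fˣ) * a l * (k₀ : Matrix (Fin (n + 1)) (Fin (n + 1)) F) l m := by
    intro l m
    rw [hg', ← mul_assoc, ← map_mul, Units.val_mul, coe_glDiagonal, Matrix.diagonal_mul, Pi.mul_apply,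
      Units.val_mul]
  have hg'L : ∀ m : Fin (n + 1), (g' : Matrix (Fin (n + 1)) (Fin (n + 1)) F) L m =
      τ₀⁻¹ * (k₀ : Matrix (Fin (n + 1)) (Fin (n + 1)) F) L m := by
    intro m
    rw [hg'apply, hz, _root_.mul_inv_rev, Units.val_mul, Units.val_inv_eq_inv_val, Units.val_inv_eq_inv_val,
      Units.val_mk0, mul_assoc ((τ₀⁻¹ : F)), inv_mul_cancel₀ (a L).ne_zero, mul_one]
  have hg'LL : (g' : Matrix (Fin (n + 1)) (Fin (n + 1)) F) L L = 1 := by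
    rw [hg'L, ← hτ₀, inv_mul_cancel₀ hτ₀0]
  -- the row matrix `κ = 1 + e_n ⊗ D'`, `D' = g'_{n,·} - e_n`
  set D' : Fin (n + 1) → F := fun m => (g' : Matrix (Fin (n + 1)) (Fin (n + 1)) F) L m -
    if L = m then 1 else 0 with hD'
  have hD'L : D' L = 0 := by
    simp only [hD']
    rw [hg'LL, if_pos trivial, sub_self]
  have hD'v : ∀ m, 𝓋 (D' m) ≤ exp (-m₀) := by
    intro m
    by_cases hm : m = L
    · rw [hm, hD'L, Valuation.map_zero]; exact zero_le
    · simp only [hD']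
      rw [if_neg (Ne.symm hm), sub_zero, hg'L, Valuation.map_mul, map_inv₀, hτ₀v, inv_one, one_mul]
      exact hlast m hm
  have hκ1 : 1 + D' L ≠ 0 := by rw [hD'L, add_zero]; exact one_ne_zero
  set κ : GL (Fin (n + 1)) F := rowGL D' L hκ1 with hκ
  have hκapply := rowGL_apply D' L hκ1
  have hκlevel : ∀ l m : Fin (n + 1),
      𝓋 ((((κ : GL (Fin (n + 1)) F) : Matrix (Fin (n + 1)) (Fin (n + 1)) F) - 1) l m * t m) ≤
        exp (-M) * 𝓋 (t l : F) := by
    intro l m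
    rw [Matrix.sub_apply, hκapply, Matrix.one_apply, add_sub_cancel_left]
    by_cases hl : l = L
    · rw [if_pos hl, hl, Valuation.map_mul]
      calc 𝓋 (D' m) * 𝓋 (t m : F) ≤ exp (-m₀) * 𝓋 (t 0 : F) :=
            mul_le_mul' (hD'v m) (hmono 0 m (Fin.zero_le _))
        _ ≤ exp (-M) * 𝓋 (t L : F) := hm₀
    · rw [if_neg hl, zero_mul, Valuation.map_zero]
      exact zero_le
  have hκlevel' : ∀ l m : Fin (n + 1),
      𝓋 ((((κ⁻¹ : GL (Fin (n + 1)) F) : Matrix (Fin (n + 1)) (Fin (n + 1)) F) - 1) l m * t m) ≤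
        exp (-M) * 𝓋 (t l : F) := by
    intro l m
    have h := hκlevel l m
    rw [Matrix.sub_apply, hκapply, Matrix.one_apply, add_sub_cancel_left] at h
    rw [Matrix.sub_apply, hκ, rowGL_inv_apply, Matrix.one_apply, add_sub_cancel_left, hD'L, add_zero,
      inv_one]
    by_cases hl : l = L
    · rw [if_pos hl, Valuation.map_mul, Valuation.map_mul, Valuation.map_neg, Valuation.map_one, one_mul,
        ← Valuation.map_mul]
      rw [if_pos hl] at h
      exact h
    · rw [if_neg hl, zero_mul, Valuation.map_zero]
      exact zero_le
  have hκK : κ ∈ valuedCongruenceSubgroup (Fin (n + 1)) (1 : ℤᵐ⁰) := by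
    have hD'1 : ∀ m, 𝓋 (D' m) ≤ 1 := fun m => (hD'v m).trans hm₀1.le
    refine ⟨fun l m => ?_, fun l m => ?_, fun l m => ?_⟩
    · rw [hκapply]
      refine Valuation.map_add_le _ ?_ ?_
      · split_ifs <;> simp
      · split_ifs
        · exact hD'1 m
        · simp
    · rw [hκ, rowGL_inv_apply, hD'L, add_zero, inv_one]
      refine Valuation.map_add_le _ ?_ ?_
      · split_ifs <;> simp
      · split_ifs
        · rw [Valuation.map_mul, Valuation.map_neg, Valuation.map_one, one_mul]
          exact hD'1 m
        · simp
    · rw [Matrix.sub_apply, hκapply, Matrix.one_apply, add_sub_cancel_left]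
      split_ifs
      · exact hD'1 m
      · simp
  -- `p = g' κ⁻¹`: unit last row, `W p ≠ 0`
  have hprow : ∀ m : Fin (n + 1), ((g' * κ⁻¹ : GL (Fin (n + 1)) F) : Matrix (Fin (n + 1)) (Fin (n + 1)) F) L m =
      if L = m then 1 else 0 := by
    intro m
    have hrowκ : ∀ x : Fin (n + 1), (g' : Matrix (Fin (n + 1)) (Fin (n + 1)) F) L x =
        ((κ : GL (Fin (n + 1)) F) : Matrix (Fin (n + 1)) (Fin (n + 1)) F) L x := by
      intro x
      rw [hκapply, if_pos rfl]
      simp only [hD']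
      ring
    rw [Units.val_mul, Matrix.mul_apply]
    simp_rw [hrowκ]
    rw [← Matrix.mul_apply, ← Units.val_mul, mul_inv_cancel, Units.val_one, Matrix.one_apply]
  have hWp : W (g' * κ⁻¹) ≠ 0 := by
    have h := hW.level κ hκlevel hκlevel' (g' * κ⁻¹)
    rw [inv_mul_cancel_right] at h
    rwa [h] at hne'
  have hp : g' * κ⁻¹ ∈ cornerGL (n + 1) F (n + 1) := by
    intro l m hlm
    exfalso
    rcases hlm with h | h
    · exact absurd l.2 (not_lt.2 h)
    · exact absurd m.2 (not_lt.2 h)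
  obtain ⟨b, hb, c, hc, hpc⟩ := exists_colGL_mul_of_row_eq L rfl hp hprow
  have hWc : W c ≠ 0 := by
    have h := hW.left (colGL b L (hb _ le_rfl)) (colGL_mem_upperUnitriangular b L hb) c
    rw [← hpc] at h
    intro h0
    rw [h0, mul_zero] at h
    exact hWp h
  obtain ⟨u', hu', k', hk', hck⟩ :=
    exists_eq_unipotent_mul_integral_of_mem_cornerGL ψ hψ hM₁ hmono hgap hW (Nat.lt_succ_self n) hc hWc
  -- `diag(z⁻¹ a) = (u u') (k' κ k₀⁻¹)`
  have hdiag : glDiagonal (n + 1) F (fun i => z⁻¹ * a i) = (colGL b L (hb _ le_rfl) * u') * (k' * κ * k₀⁻¹) := by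
    have h1 : glDiagonal (n + 1) F (fun i => z⁻¹ * a i) * k₀ = g' := by
      rw [hg', ← mul_assoc, ← map_mul]
      rfl
    have h2 : g' = colGL b L (hb _ le_rfl) * u' * k' * κ := by
      rw [mul_assoc (colGL b L _), ← hck, ← hpc, inv_mul_cancel_right]
    calc glDiagonal (n + 1) F (fun i => z⁻¹ * a i)
        = glDiagonal (n + 1) F (fun i => z⁻¹ * a i) * k₀ * k₀⁻¹ := by rw [mul_inv_cancel_right]
      _ = colGL b L (hb _ le_rfl) * u' * k' * κ * k₀⁻¹ := by rw [h1, h2]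
      _ = _ := by simp only [mul_assoc]
  have hunit := valuation_eq_one_of_glDiagonal_eq_mul
    (mul_mem (colGL_mem_upperUnitriangular b L hb) hu') (mul_mem (mul_mem hk' hκK) (inv_mem hk₀)) hdiag i
  -- `|z⁻¹ a_i| = 1` and `|z| = |a_n|`
  have hzv : 𝓋 (z : F) = 𝓋 (a L : F) := by
    rw [hz, Units.val_mul, Units.val_mk0, Valuation.map_mul, hτ₀v, mul_one]
  rw [Units.val_mul, Units.val_inv_eq_inv_val, Valuation.map_mul, map_inv₀, hzv] at hunit
  have ha0 : 𝓋 (a L : F) ≠ 0 := (Valuation.ne_zero_iff _).2 (a L).ne_zero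
  have key := congrArg (fun x => 𝓋 (a L : F) * x) hunit
  rwa [← mul_assoc, mul_inv_cancel₀ ha0, one_mul, mul_one] at key

end Main

end WhittakerSupport

end Literature.NumberTheory.Automorphic
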